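import Summits.CriticalPhenomena.PercolationContinuityZ3.Theorems.PercNearOneGluingNoHeavyLowerTailSahiHittingBoxMemoPrelim
import Std.Data.HashSet.Lemmas
import HarnessLib

/-!
# `NoHeavyLowerTail` (stmt-CriticalPhenomena-4575) — box positivity by pruned Bernstein recursion with ACTUAL DEGREES and a CACHE OF
# VERIFIED NODES UP TO VARIABLE RELABELLING (the order-6 engine for Sahi positivity of hitting events)

Support file, seat `prim-l12-p5` (gen 11), `--supports stmt-CriticalPhenomena-4575`.  Standard axioms; computable `List`/`Std.HashSet` operations; no
sorries, no `native_decide` here (certificate files run `boxcheckM` by `native_decide`).  Infrastructure: `…SahiHittingBoxMemoPrelim`.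
`bcM` refines `boxcheckK` of `…SahiHittingBoxRecursive` (same term lists, same `evalKL`, same greedy domination `domGo`) by three EXACT prunings:
(1) ACTUAL DEGREE — slice an occurring variable of least actual degree with Bernstein degree = its maximal exponent at the node (`pickVar`);
(2) RELABELLING CACHE — the unit box is invariant under coordinate permutations, so a node whose heuristic canonical form `canonK` (relabel the
occurring variables along `canonOrd`, normalise; the colour-refinement signatures `sigs` only CHOOSE the relabelling) lies in the `Std.HashSet` of
verified canonical forms is verified — soundness uses only `Std.HashSet.mem_insert`/`mem_iff_contains`/`not_mem_empty` and the relabelling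
identities of the Prelim file; (3) budgets of the domination test most-specific-first (`dominatedK2`).  Numbers (C++ mirror `code/g11/mirror.cpp`):
order-5 universal hitting polynomial (31 variables) 3.7·10⁴ nodes at `memoMin = 40` (gen 10: 6.07·10⁷); order 6 depth ≤ 3 (41 variables) 1.0·10⁶
(gen 10: > 4·10⁸); order 6 in full (63 variables) a few ·10⁷, split over certificate files via `nodeK`.
* `mix64`, `termSig`, `bumpSig`, `sigRound`, `sigs`, `canonOrd`, `canonK`, `nonneg_of_canonK`, `canonK_nonneg`; `dominatedK2`, `dominatedK2_sound`;
* `goChildren`, `childrenK`, **`bcM`**, **`boxcheckM`**, `bcM_sound`, **`evalKL_nonneg_of_boxcheckM`** (`boxcheckM memoMin fuel L = true`, keys of length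
  `≤ k` ⟹ `0 ≤ evalKL k L x` on `[0,1]^k`);
* `nonneg_of_pickVar_children`, `stepK`, `nodeK`, `nonneg_nodeK_of_children`, `nonneg_nodeK_of_boxcheckM` — nodes of the recursion tree addressed by
  index paths, for certificates split over several files. [this work; folklore: Bernstein branch-and-bound, hashing modulo symmetry]
-/

namespace Summit.CriticalPhenomena.PercolationContinuityZ3.Theorems
namespace SahiHitting

open Finset SparseBernstein

variable {k : ℕ}

/-! ## D. Heuristic canonical relabelling (signatures by colour refinement; soundness never looks at them) -/

/-- One mixing step on 64-bit words. [folklore] -/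
@[inline] def mix64 (h v : UInt64) : UInt64 :=
  let h1 : UInt64 := h ^^^ (v + (0x9E3779B97F4A7C15 : UInt64) + (h <<< (6 : UInt64)) + (h >>> (2 : UInt64)))
  let h2 : UInt64 := h1 * (0xFF51AFD7ED558CCD : UInt64)
  h2 ^^^ (h2 >>> (33 : UInt64))

/-- Accumulate, along an exponent list, `acc[j] += g e_j sig[j]` for the nonzero exponents. [this work] -/
def bumpSig (g : ℕ → UInt64 → UInt64) : List ℕ → ℕ → Array UInt64 → Array UInt64 → Array UInt64
  | [], _, _, acc => acc
  | e :: es, j, sig, acc => bumpSig g es (j + 1) sig (if e = 0 then acc else acc.modify j fun a => a + g e (sig.getD j 0))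

/-- Symmetric hash of a term relative to the current signatures. [this work] -/
def termSig (sig : Array UInt64) (t : ℤ × List ℕ) : UInt64 :=
  let r := t.2.foldl (fun (acc : UInt64 × ℕ × ℕ × ℕ) e =>
      let (ms, td, nv, j) := acc
      if e = 0 then (ms, td, nv, j + 1) else (ms + mix64 (sig.getD j 0) (UInt64.ofNat e), td + e, nv + 1, j + 1)) (0, 0, 0, 0)
  mix64 (mix64 (mix64 (UInt64.ofNat (Int.toNat (t.1 + 1000000))) (UInt64.ofNat r.2.1)) (UInt64.ofNat r.2.2.1)) r.1

/-- One refinement round of the variable signatures. [this work] -/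
def sigRound (L : List (ℤ × List ℕ)) (m : ℕ) (sig : Array UInt64) : Array UInt64 :=
  L.foldl (fun acc t => let th := termSig sig t
      bumpSig (fun e sj => mix64 th (mix64 sj (UInt64.ofNat e) * 31 + UInt64.ofNat e)) t.2 0 sig acc)
    (Array.replicate m 0)

/-- Variable signatures after three refinement rounds, seeded with the actual degrees. [this work] -/
def sigs (L : List (ℤ × List ℕ)) (dk : List ℕ) : Array UInt64 :=
  let m := dk.length
  let s0 : Array UInt64 := (dk.map UInt64.ofNat).toArray
  sigRound L m (sigRound L m (sigRound L m s0))

/-- The relabelling order: occurring variables sorted by (actual degree, signature). [this work] -/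
def canonOrd (L : List (ℤ × List ℕ)) : List ℕ :=
  let dk := degKey L
  let da := dk.toArray
  let s := sigs L dk
  (occVars L).mergeSort fun a b =>
    Nat.blt (da.getD a 0) (da.getD b 0) || (da.getD a 0 == da.getD b 0 && decide (s.getD a 0 ≤ s.getD b 0))

/-- The canonical order is a permutation of the occurring variables. [this work] -/
theorem canonOrd_perm (L : List (ℤ × List ℕ)) : (canonOrd L).Perm (occVars L) := List.mergeSort_perm _ _

/-- Canonical form (modulo the heuristic): relabel along `canonOrd`, then normalise. [this work] -/
def canonK (L : List (ℤ × List ℕ)) : List (ℤ × List ℕ) := normK (relabelK (canonOrd L) L)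

/-- Box-nonnegativity of the canonical form gives box-nonnegativity (keys of length `≤ k`). [this work] -/
theorem nonneg_of_canonK {L : List (ℤ × List ℕ)} (hlen : ∀ t ∈ L, t.2.length ≤ k)
    (h : ∀ y : Fin k → ℝ, (∀ i, 0 ≤ y i ∧ y i ≤ 1) → 0 ≤ evalKL k (canonK L) y)
    (x : Fin k → ℝ) (hx : ∀ i, 0 ≤ x i ∧ x i ≤ 1) : 0 ≤ evalKL k L x := by
  have hperm := canonOrd_perm L
  have hcov : ∀ t ∈ L, ∀ j, t.2.getD j 0 ≠ 0 → j ∈ canonOrd L := fun t ht j hj => hperm.mem_iff.2 (mem_occVars ht hj)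
  have hnd : (canonOrd L).Nodup := hperm.nodup_iff.2 (nodup_idxPos _ _)
  have hlt : ∀ j ∈ canonOrd L, j < k := fun j hj =>
    (lt_of_mem_occVars (hperm.mem_iff.1 hj)).trans_le (degKey_length_le L k hlen)
  rw [← evalKL_relabelK (canonOrd L) L hcov hnd hlt x]
  exact nonneg_of_normK (h _ (pushX_box _ hx))

/-- Box-nonnegativity passes to the normal form. [this work] -/
theorem normK_nonneg {L : List (ℤ × List ℕ)} {x : Fin k → ℝ} (h : 0 ≤ evalKL k L x) : 0 ≤ evalKL k (normK L) x := by
  obtain ⟨c, hc, hcx⟩ := evalKL_primK (dropZeroK (mergeAdj (sortK L))) x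
  rw [← evalKL_dms L x, hcx] at h
  unfold normK
  nlinarith [mul_nonneg hc.le (le_refl (0 : ℝ)), hc]

/-- The pulled-back point: old coordinate `j` reads new coordinate `ord.idxOf j` (else `0`). [this work] -/
noncomputable def pullX (ord : List ℕ) (y : Fin k → ℝ) : Fin k → ℝ := fun j => xN y (ord.idxOf j.1)

/-- The pulled-back point lies in the box. [this work] -/
theorem pullX_box (ord : List ℕ) {y : Fin k → ℝ} (hy : ∀ i, 0 ≤ y i ∧ y i ≤ 1) (j : Fin k) :
    0 ≤ pullX ord y j ∧ pullX ord y j ≤ 1 := by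
  unfold pullX xN; split_ifs
  · exact hy _
  · exact ⟨le_rfl, zero_le_one⟩

/-- **The relabelling identity, pulled back**: `evalKL (relabelK ord L) y = evalKL L (pullX ord y)`. [this work] -/
theorem evalKL_relabelK_pull (ord : List ℕ) (L : List (ℤ × List ℕ)) (hcov : ∀ t ∈ L, ∀ j, t.2.getD j 0 ≠ 0 → j ∈ ord)
    (hnd : ord.Nodup) (hlt : ∀ j ∈ ord, j < k) (y : Fin k → ℝ) :
    evalKL k (relabelK ord L) y = evalKL k L (pullX ord y) := by
  unfold evalKL relabelK
  rw [List.map_map]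
  congr 1
  refine List.map_congr_left fun t ht => ?_
  simp only [Function.comp]
  congr 1
  have hlen : ord.length ≤ k := length_le_of_nodup_lt hnd hlt
  set g : ℕ → ℝ := fun i => xN y i ^ t.2.getD (ord.getD i k) 0 with hg
  -- left: the relabelled monomial at `y`
  have lhs : (∏ i : Fin k, y i ^ (ord.map fun j => t.2.toArray.getD j 0).getD i.1 0) = ((List.range ord.length).map g).prod := by
    have h1 : (∏ i : Fin k, y i ^ (ord.map fun j => t.2.toArray.getD j 0).getD i.1 0)
        = ∏ i ∈ Finset.range k, (if i < ord.length then g i else 1) := by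
      rw [← Fin.prod_univ_eq_prod_range]
      refine Finset.prod_congr rfl fun i _ => ?_
      by_cases hi : i.1 < ord.length
      · rw [if_pos hi]
        simp only [hg, xN, dif_pos i.2, List.getD_eq_getElem?_getD, List.getElem?_map, List.getElem?_eq_getElem hi, Option.map_some,
          Option.getD_some, array_getD_eq]
      · rw [if_neg hi]
        simp [List.getD_eq_getElem?_getD, List.getElem?_eq_none (show (ord.map _).length ≤ i.1 by simpa using hi)]
    have h2 : (∏ i ∈ Finset.range k, (if i < ord.length then g i else 1)) = ∏ i ∈ Finset.range ord.length, g i := by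
      rw [← Finset.prod_subset (Finset.range_mono hlen) (fun i _ hi => by rw [if_neg (by simpa using hi)])]
      exact Finset.prod_congr rfl fun i hi => if_pos (Finset.mem_range.1 hi)
    rw [h1, h2, ← List.toFinset_range, List.prod_toFinset _ List.nodup_range]
  -- right: the original monomial at the pulled-back point
  have rhs : (∏ j : Fin k, pullX ord y j ^ t.2.getD j.1 0) = ((List.range ord.length).map g).prod := by
    set f : ℕ → ℝ := fun j => xN y (ord.idxOf j) ^ t.2.getD j 0 with hf
    have h1 : (∏ j : Fin k, pullX ord y j ^ t.2.getD j.1 0) = ∏ j ∈ Finset.range k, f j := by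
      rw [← Fin.prod_univ_eq_prod_range]
      exact Finset.prod_congr rfl fun j _ => by simp [hf, pullX]
    rw [h1, ← Finset.prod_subset (s₁ := ord.toFinset) (fun j hj => Finset.mem_range.2 (hlt j (List.mem_toFinset.1 hj)))
      (fun j _ hj => by
        have : t.2[j]?.getD 0 = 0 := by
          rw [← List.getD_eq_getElem?_getD]; by_contra hne; exact hj (List.mem_toFinset.2 (hcov t ht j hne))
        simp [hf, this]),
      List.prod_toFinset _ hnd, ← map_range_getD f ord k]
    congr 1
    refine List.map_congr_left fun i hi => ?_
    have hi : i < ord.length := List.mem_range.1 hi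
    simp only [hf, hg, List.getD_eq_getElem?_getD, List.getElem?_eq_getElem hi, Option.getD_some]
    rw [hnd.idxOf_getElem i hi]
  rw [lhs, rhs]

/-- Box-nonnegativity passes to the canonical form (keys of length `≤ k`). [this work] -/
theorem canonK_nonneg {L : List (ℤ × List ℕ)} (hlen : ∀ t ∈ L, t.2.length ≤ k)
    (h : ∀ x : Fin k → ℝ, (∀ i, 0 ≤ x i ∧ x i ≤ 1) → 0 ≤ evalKL k L x)
    (y : Fin k → ℝ) (hy : ∀ i, 0 ≤ y i ∧ y i ≤ 1) : 0 ≤ evalKL k (canonK L) y := by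
  have hperm := canonOrd_perm L
  have hcov : ∀ t ∈ L, ∀ j, t.2.getD j 0 ≠ 0 → j ∈ canonOrd L := fun t ht j hj => hperm.mem_iff.2 (mem_occVars ht hj)
  have hnd : (canonOrd L).Nodup := hperm.nodup_iff.2 (nodup_idxPos _ _)
  have hlt : ∀ j ∈ canonOrd L, j < k := fun j hj =>
    (lt_of_mem_occVars (hperm.mem_iff.1 hj)).trans_le (degKey_length_le L k hlen)
  refine normK_nonneg ?_
  rw [evalKL_relabelK_pull (canonOrd L) L hcov hnd hlt y]
  exact h _ (pullX_box _ hy)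

/-- Keys of the canonical form have length `≤ k` (keys of the input having length `≤ k`). [this work] -/
theorem length_le_of_mem_canonK {L : List (ℤ × List ℕ)} (hlen : ∀ t ∈ L, t.2.length ≤ k) {u : ℤ × List ℕ} (hu : u ∈ canonK L) :
    u.2.length ≤ k := by
  obtain ⟨t, ht, htu⟩ := key_of_mem_normK hu
  obtain ⟨s, _, rfl⟩ := List.mem_map.1 ht
  rw [htu]
  simp only [List.length_map]
  rw [(canonOrd_perm L).length_eq]
  exact (length_idxPos_le _ _).trans (degKey_length_le L k hlen)

/-! ## E. Domination with most-specific budgets first -/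

/-- Total degree of a term. [folklore] -/
def tdegK (t : ℤ × List ℕ) : ℕ := t.2.foldr (· + ·) 0

/-- The domination leaf test with the positive budgets sorted by decreasing total degree. [this work] -/
def dominatedK2 (L : List (ℤ × List ℕ)) : Bool :=
  domGo L ((L.filter fun t => decide (0 < t.1)).mergeSort fun s t => Nat.ble (tdegK t) (tdegK s))

/-- Soundness of `dominatedK2`. [this work] -/
theorem dominatedK2_sound {L : List (ℤ × List ℕ)} (h : dominatedK2 L = true) {x : Fin k → ℝ} (hx : ∀ i, 0 ≤ x i ∧ x i ≤ 1) :
    0 ≤ evalKL k L x := by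
  rw [evalKL_split L x, ← evalKL_perm (List.mergeSort_perm (L.filter fun t => decide (0 < t.1))
    (fun s t => Nat.ble (tdegK t) (tdegK s)))]
  refine domGo_sound hx L _ (fun p hp => ?_) h
  have := (List.mem_filter.1 ((List.mergeSort_perm _ _).subset hp)).2
  simp only [decide_eq_true_eq] at this
  exact this.le

/-! ## F. The memoising checker and its soundness -/

/-- Run the checker on each child, threading the cache; `none` at the first failure. [this work] -/
def goChildren (rec : Std.HashSet (List (ℤ × List ℕ)) → List (ℤ × List ℕ) → Option (Std.HashSet (List (ℤ × List ℕ)))) :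
    Std.HashSet (List (ℤ × List ℕ)) → List (List (ℤ × List ℕ)) → Option (Std.HashSet (List (ℤ × List ℕ)))
  | cache, [] => some cache
  | cache, C :: Cs => match rec cache C with
    | none => none
    | some cache' => goChildren rec cache' Cs

/-- The children of `C` at variable `i` with actual degree `d`: the normalised scaled Bernstein slices `a = 0, …, d`. [this work] -/
def childrenK (i d : ℕ) (C : List (ℤ × List ℕ)) : List (List (ℤ × List ℕ)) :=
  (List.range (d + 1)).map fun a => normK (sliceRaw i d a C)

/-- **The memoising pruned Bernstein recursion** (fuel, cache of verified normal forms, current node); `memoMin` = minimal number of terms for canonicalisation and caching.  Returns the enlarged cache, or `none` on failure. [this work] -/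
def bcM (memoMin : ℕ) : ℕ → Std.HashSet (List (ℤ × List ℕ)) → List (ℤ × List ℕ) → Option (Std.HashSet (List (ℤ × List ℕ)))
  | 0, _, _ => none
  | fuel + 1, cache, L =>
    if dominatedK2 L then some cache else
    if memoMin ≤ L.length then
      if cache.contains (canonK L) then some cache else
      match pickVar L with
      | none => none
      | some (i, d) =>
        match goChildren (bcM memoMin fuel) cache (childrenK i d L) with
        | none => none
        | some cache' => some (cache'.insert (canonK L))
    else
      match pickVar L with
      | none => none
      | some (i, d) => goChildren (bcM memoMin fuel) cache (childrenK i d L)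

/-- **The checker**: run `bcM` from the empty cache. [this work] -/
def boxcheckM (memoMin fuel : ℕ) (L : List (ℤ × List ℕ)) : Bool := (bcM memoMin fuel ∅ L).isSome

/-- `goChildren` succeeds only if every child succeeds, and then preserves any invariant preserved by `rec`. [this work] -/
theorem goChildren_spec {rec : Std.HashSet (List (ℤ × List ℕ)) → List (ℤ × List ℕ) → Option (Std.HashSet (List (ℤ × List ℕ)))}
    {Inv : Std.HashSet (List (ℤ × List ℕ)) → Prop} {P Q : List (ℤ × List ℕ) → Prop}
    (hrec : ∀ cache C cache', rec cache C = some cache' → Inv cache → P C → Inv cache' ∧ Q C) :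
    ∀ (Cs : List (List (ℤ × List ℕ))) (cache cache' : Std.HashSet (List (ℤ × List ℕ))),
      goChildren rec cache Cs = some cache' → Inv cache → (∀ C ∈ Cs, P C) → Inv cache' ∧ ∀ C ∈ Cs, Q C
  | [], cache, cache', h, hI, _ => by
    simp only [goChildren, Option.some.injEq] at h
    exact ⟨h ▸ hI, fun C hC => by simp at hC⟩
  | C :: Cs, cache, cache', h, hI, hP => by
    simp only [goChildren] at h
    split at h
    · simp at h
    · next cache'' hC =>
      obtain ⟨hI'', hQ⟩ := hrec cache C cache'' hC hI (hP C (by simp))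
      obtain ⟨hI', hQs⟩ := goChildren_spec hrec Cs cache'' cache' h hI'' fun C' hC' => hP C' (by simp [hC'])
      exact ⟨hI', fun C' hC' => by
        rcases List.mem_cons.1 hC' with rfl | hC'
        · exact hQ
        · exact hQs C' hC'⟩

/-- From the children to the node: if every normalised slice at `(i, d)` is box-nonnegative, `d` bounds the exponents of `x_i` and `i < k`, then the node is box-nonnegative. [this work] -/
theorem nonneg_of_children {C : List (ℤ × List ℕ)} {i d : ℕ} (hi : i < k) (hd : ∀ t ∈ C, t.2.getD i 0 ≤ d)
    (h : ∀ M ∈ childrenK i d C, ∀ y : Fin k → ℝ, (∀ j, 0 ≤ y j ∧ y j ≤ 1) → 0 ≤ evalKL k M y)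
    (x : Fin k → ℝ) (hx : ∀ j, 0 ≤ x j ∧ x j ≤ 1) : 0 ≤ evalKL k C x := by
  rw [evalKL_slice_expand hi d C hd x]
  refine Finset.sum_nonneg fun a ha => mul_nonneg (mul_nonneg (pow_nonneg (hx _).1 _) (pow_nonneg (sub_nonneg.2 (hx _).2) _)) ?_
  rw [slice1K, evalKL_dropZeroK, evalKL_mergeK]
  refine nonneg_of_normK (h _ ?_ x hx)
  exact List.mem_map.2 ⟨a, by simpa using ha, rfl⟩

/-- Keys of the children are keys of the node with entry `i` zeroed (so key lengths do not grow). [this work] -/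
theorem length_le_of_mem_childrenK {C : List (ℤ × List ℕ)} {i d m : ℕ} (hlen : ∀ t ∈ C, t.2.length ≤ m)
    {M : List (ℤ × List ℕ)} (hM : M ∈ childrenK i d C) {u : ℤ × List ℕ} (hu : u ∈ M) : u.2.length ≤ m := by
  obtain ⟨a, _, rfl⟩ := List.mem_map.1 hM
  obtain ⟨t, ht, htu⟩ := key_of_mem_normK hu
  unfold sliceRaw at ht
  obtain ⟨s, hs, hst⟩ := List.mem_filterMap.1 ht
  split_ifs at hst
  rw [htu, ← Option.some.inj hst]
  simpa using hlen s hs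

/-- From the children to the node, driven by `pickVar`: if `pickVar L = (i, d)` and every normalised slice at `(i, d)` is box-nonnegative, so is `L` (keys of length `≤ k`). [this work] -/
theorem nonneg_of_pickVar_children {L : List (ℤ × List ℕ)} {i d : ℕ} (hp : pickVar L = some (i, d)) (hlen : ∀ t ∈ L, t.2.length ≤ k)
    (h : ∀ a, a ≤ d → ∀ y : Fin k → ℝ, (∀ j, 0 ≤ y j ∧ y j ≤ 1) → 0 ≤ evalKL k (normK (sliceRaw i d a L)) y)
    (x : Fin k → ℝ) (hx : ∀ j, 0 ≤ x j ∧ x j ≤ 1) : 0 ≤ evalKL k L x := by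
  obtain ⟨hdeg, hdpos⟩ := pickVar_spec hp
  have hdL : ∀ t ∈ L, t.2.getD i 0 ≤ d := fun t ht => hdeg ▸ getD_le_degKey L t ht i
  have hi : i < k := by
    have : i < (degKey L).length := by
      by_contra hge
      have : (degKey L).getD i 0 = 0 := by
        rw [List.getD_eq_getElem?_getD, List.getElem?_eq_none_iff.2 (by omega)]; rfl
      omega
    exact this.trans_le (degKey_length_le L k hlen)
  refine nonneg_of_children hi hdL (fun M hM y hy => ?_) x hx
  obtain ⟨a, ha, rfl⟩ := List.mem_map.1 hM
  exact h a (by simpa [Nat.lt_succ_iff] using ha) y hy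

/-- **Soundness of `bcM`**: if the cache holds only box-nonnegative term lists and all keys of `L` have length `≤ k`, then a successful run returns a cache holding only box-nonnegative term lists, and `L` is box-nonnegative. [this work] -/
theorem bcM_sound (memoMin : ℕ) : ∀ (fuel : ℕ) (cache : Std.HashSet (List (ℤ × List ℕ))) (L : List (ℤ × List ℕ))
    (cache' : Std.HashSet (List (ℤ × List ℕ))), bcM memoMin fuel cache L = some cache' →
    (∀ M ∈ cache, ∀ y : Fin k → ℝ, (∀ j, 0 ≤ y j ∧ y j ≤ 1) → 0 ≤ evalKL k M y) → (∀ t ∈ L, t.2.length ≤ k) →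
    (∀ M ∈ cache', ∀ y : Fin k → ℝ, (∀ j, 0 ≤ y j ∧ y j ≤ 1) → 0 ≤ evalKL k M y) ∧
      ∀ x : Fin k → ℝ, (∀ j, 0 ≤ x j ∧ x j ≤ 1) → 0 ≤ evalKL k L x
  | 0, cache, L, cache', h, _, _ => by simp [bcM] at h
  | fuel + 1, cache, L, cache', h, hcache, hlen => by
    rw [bcM] at h
    by_cases hdom : dominatedK2 L = true
    · rw [if_pos hdom, Option.some.injEq] at h
      exact ⟨h ▸ hcache, fun x hx => dominatedK2_sound hdom hx⟩
    rw [if_neg hdom] at h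
    -- common tail: verification of a node `C` (with keys of length ≤ k) from its children
    have node : ∀ (C : List (ℤ × List ℕ)) (i d : ℕ) (c c' : Std.HashSet (List (ℤ × List ℕ))),
        pickVar C = some (i, d) → goChildren (bcM memoMin fuel) c (childrenK i d C) = some c' →
        (∀ M ∈ c, ∀ y : Fin k → ℝ, (∀ j, 0 ≤ y j ∧ y j ≤ 1) → 0 ≤ evalKL k M y) → (∀ t ∈ C, t.2.length ≤ k) →
        (∀ M ∈ c', ∀ y : Fin k → ℝ, (∀ j, 0 ≤ y j ∧ y j ≤ 1) → 0 ≤ evalKL k M y) ∧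
          ∀ x : Fin k → ℝ, (∀ j, 0 ≤ x j ∧ x j ≤ 1) → 0 ≤ evalKL k C x := by
      intro C i d c c' hpick hgo hc hlenC
      obtain ⟨hc', hkids⟩ := goChildren_spec (Inv := fun cc => ∀ M ∈ cc, ∀ y : Fin k → ℝ, (∀ j, 0 ≤ y j ∧ y j ≤ 1) → 0 ≤ evalKL k M y)
        (P := fun M => ∀ t ∈ M, t.2.length ≤ k) (Q := fun M => ∀ x : Fin k → ℝ, (∀ j, 0 ≤ x j ∧ x j ≤ 1) → 0 ≤ evalKL k M x)
        (bcM_sound memoMin fuel) (childrenK i d C) c c' hgo hc (fun M hM u hu => length_le_of_mem_childrenK hlenC hM hu)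
      exact ⟨hc', nonneg_of_pickVar_children hpick hlenC fun a ha y hy =>
        hkids _ (List.mem_map.2 ⟨a, List.mem_range.2 (Nat.lt_succ_of_le ha), rfl⟩) y hy⟩
    by_cases hbig : memoMin ≤ L.length
    · rw [if_pos hbig] at h
      by_cases hhit : cache.contains (canonK L) = true
      · rw [if_pos hhit, Option.some.injEq] at h
        subst h
        refine ⟨hcache, nonneg_of_canonK hlen (hcache _ (Std.HashSet.mem_iff_contains.2 hhit))⟩
      rw [if_neg hhit] at h
      split at h
      · simp at h
      · next i d hpick =>
        split at h
        · simp at h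
        · next cache'' hgo =>
          rw [Option.some.injEq] at h
          subst h
          obtain ⟨hc'', hL⟩ := node L i d cache cache'' hpick hgo hcache hlen
          refine ⟨fun M hM => ?_, hL⟩
          rcases Std.HashSet.mem_insert.1 hM with hMC | hM
          · rw [← eq_of_beq hMC]; exact canonK_nonneg hlen hL
          · exact hc'' M hM
    · rw [if_neg hbig] at h
      split at h
      · simp at h
      · next i d hpick => exact node L i d cache cache' hpick h hcache hlen

/-- **Soundness of the checker**: `boxcheckM memoMin fuel L = true`, with all keys of length `≤ k`, gives `0 ≤ evalKL k L x` on the unit box. [this work] -/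
theorem evalKL_nonneg_of_boxcheckM {memoMin fuel : ℕ} {L : List (ℤ × List ℕ)} (h : boxcheckM memoMin fuel L = true)
    (hlen : ∀ t ∈ L, t.2.length ≤ k) (x : Fin k → ℝ) (hx : ∀ i, 0 ≤ x i ∧ x i ≤ 1) : 0 ≤ evalKL k L x := by
  unfold boxcheckM at h
  obtain ⟨cache', hc⟩ := Option.isSome_iff_exists.1 h
  exact (bcM_sound memoMin fuel ∅ L cache' hc (fun M hM => absurd hM Std.HashSet.not_mem_empty) hlen).2 x hx

/-! ## G. Assembly helpers: explicit slicing steps, for certificates split over several files -/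

/-- One explicit slicing step: the `a`-th normalised slice at the variable chosen by `pickVar` (identity if no variable occurs). [this work] -/
def stepK (L : List (ℤ × List ℕ)) (a : ℕ) : List (ℤ × List ℕ) :=
  match pickVar L with
  | none => L
  | some (i, d) => normK (sliceRaw i d a L)

/-- The node of the recursion tree reached from `L` along the index path `as`. [this work] -/
def nodeK (L : List (ℤ × List ℕ)) (as : List ℕ) : List (ℤ × List ℕ) := as.foldl stepK L

/-- Extending the path by one index is one slicing step. [this work] -/
theorem nodeK_append (L : List (ℤ × List ℕ)) (as : List ℕ) (a : ℕ) : nodeK L (as ++ [a]) = stepK (nodeK L as) a := by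
  simp [nodeK, List.foldl_append]

/-- A slicing step does not lengthen keys. [this work] -/
theorem keylen_stepK {L : List (ℤ × List ℕ)} {m : ℕ} (hlen : ∀ t ∈ L, t.2.length ≤ m) (a : ℕ) : ∀ t ∈ stepK L a, t.2.length ≤ m := by
  intro u hu
  unfold stepK at hu
  split at hu
  · exact hlen u hu
  · obtain ⟨t, ht, htu⟩ := key_of_mem_normK hu
    unfold sliceRaw at ht
    obtain ⟨s, hs, hst⟩ := List.mem_filterMap.1 ht
    split_ifs at hst
    rw [htu, ← Option.some.inj hst]
    simpa using hlen s hs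

/-- Nodes of the recursion tree have keys no longer than the root's. [this work] -/
theorem keylen_nodeK {L : List (ℤ × List ℕ)} {m : ℕ} (hlen : ∀ t ∈ L, t.2.length ≤ m) : ∀ (as : List ℕ), ∀ t ∈ nodeK L as, t.2.length ≤ m := by
  intro as
  induction as using List.reverseRecOn with
  | nil => simpa [nodeK] using hlen
  | append_singleton as a ih => rw [nodeK_append]; exact keylen_stepK ih a

/-- **Assembly step**: if `pickVar (nodeK L as) = (i, d)` and the children `nodeK L (as ++ [a])`, `a ≤ d`, are box-nonnegative, so is `nodeK L as` (root keys of length `≤ k`). [this work] -/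
theorem nonneg_nodeK_of_children {L : List (ℤ × List ℕ)} (hlen : ∀ t ∈ L, t.2.length ≤ k) {as : List ℕ} {i d : ℕ}
    (hp : pickVar (nodeK L as) = some (i, d))
    (h : ∀ a, a ≤ d → ∀ y : Fin k → ℝ, (∀ j, 0 ≤ y j ∧ y j ≤ 1) → 0 ≤ evalKL k (nodeK L (as ++ [a])) y)
    (x : Fin k → ℝ) (hx : ∀ j, 0 ≤ x j ∧ x j ≤ 1) : 0 ≤ evalKL k (nodeK L as) x := by
  refine nonneg_of_pickVar_children hp (keylen_nodeK hlen as) (fun a ha y hy => ?_) x hx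
  have := h a ha y hy
  rwa [nodeK_append, stepK, hp] at this

/-- **A certificate for a node closes that node**: `boxcheckM memoMin fuel (nodeK L as) = true` gives box-nonnegativity of `nodeK L as` (root keys of length `≤ k`). [this work] -/
theorem nonneg_nodeK_of_boxcheckM {L : List (ℤ × List ℕ)} (hlen : ∀ t ∈ L, t.2.length ≤ k) {as : List ℕ} {memoMin fuel : ℕ}
    (h : boxcheckM memoMin fuel (nodeK L as) = true) (x : Fin k → ℝ) (hx : ∀ j, 0 ≤ x j ∧ x j ≤ 1) : 0 ≤ evalKL k (nodeK L as) x :=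
  evalKL_nonneg_of_boxcheckM h (keylen_nodeK hlen as) x hx

end SahiHitting

end Summit.CriticalPhenomena.PercolationContinuityZ3.Theorems
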